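import Literature.NumberTheory.EllipticCurves.ArchimedeanKummerImageMaximal
import Literature.NumberTheory.EllipticCurves.SelmerImage
import HarnessLib

/-!
# `#H¹(K_w, E) ≤ 2` at an infinite place (Milne, *ADT*, I Rem. 3.7: `H¹(ℝ, A) ≅ π₀(A(ℝ))^∨`)

Topic `NumberTheory/EllipticCurves`; namespace `WeierstrassCurve` (dot-notation statements about a Weierstrass
curve over a number field, as the parent file `ArchimedeanKummerImageMaximal.lean`). Theorems only; **no
definition, no named fact** (D-0026).

For an elliptic curve `E = W` over a number field `K` and an infinite place `w`, the Galois cohomology group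
`H¹(K_w, E) = H¹(Γ_{K_w}, E(K̄_w))` is `0` if `w` is complex and is dual to `π₀(E(ℝ)) = E(ℝ)/E(ℝ)°` (of order
`1` or `2`) if `w` is real — Milne, *Arithmetic Duality Theorems*, I Thm. 2.13(a) and Rem. 3.7 ("for `K = ℝ`
… `H¹(ℝ, A)` is dual to `π₀(A(ℝ))`"). This file proves the ORDER statement **`#H¹(K_w, E) ≤ 2`** with no Lie
theory and no duality, by the counts already in the tree (`ArchimedeanKummerImageMaximal.lean`):
`H¹(K_w, E) = H¹(K_w, E)[2]` (`Γ_{K_w}` has order `≤ 2`), the local Kummer sequence at level `2`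
(`#H¹(K_w, E)[2] · #𝓛^{(2)} = #H¹(K_w, E[2])`), the crossed-homomorphism count
`4 · #H¹(K_w, E[2]) ≤ (#E(K_w)[2])²` and the real input `#E(K_w)[2] ≤ 2 · #𝓛^{(2)}` (a curve with full
real `2`-torsion has `E(K_w) ≠ 2E(K_w)`), whence `2 · #H¹(K_w, E) ≤ #E(K_w)[2] ≤ 4`.

* `natCard_localH1_le_two_infinitePlace` — `#H¹(K_w, E) ≤ 2` (and `finite_localH1_infinitePlace`);
* `index_localRestrictionKer_infinitePlace_le_two` — the kernel of `H¹(K, E) → H¹(K_w, E)` has index `≤ 2`;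
* `index_selmerLocalKer_infinitePlace_le_two` — the level-`n` Selmer condition at `w` (the kernel of
  `H¹(K, E[n]) → H¹(K_w, E)`) has index `≤ 2` in `H¹(K, E[n])`, for every `n`.

Written for route `GenusKolyvaginAtTwo` of `Summits/BirchSwinnertonDyer` (LINE 19, `Δ > 0`: relaxing the
archimedean Selmer condition costs at most one bit).

## References
* [MilneADT2006] J. S. Milne, *Arithmetic Duality Theorems*, 2nd ed. (2006), Ch. I Thm. 2.13(a), Rem. 3.7.
* [SilvermanAEC2009] J. H. Silverman, *The Arithmetic of Elliptic Curves*, 2nd ed., X.§4 (diagram (**)).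
-/

noncomputable section

open scoped Classical

universe u

namespace WeierstrassCurve

open Literature.NumberTheory.EllipticCurves Literature.NumberTheory.GaloisRepresentations Field Function
  NumberField

variable {K : Type u} [Field K] [NumberField K] (W : WeierstrassCurve K) [W.IsElliptic]

/-- Arithmetic of the real case: `T·L = H`, `4H ≤ t²`, `t ≤ 2L`, `t ≤ 4`, `0 < L` force `T ≤ 2`. [folklore] -/
private theorem le_two_of_counts {T L H t : ℕ} (e : T * L = H) (hC : 4 * H ≤ t ^ 2) (ht : t ≤ 2 * L)
    (ht4 : t ≤ 4) (hL : 0 < L) : T ≤ 2 := by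
  have key : 4 * L * T ≤ 4 * L * 2 :=
    calc 4 * L * T = 4 * H := by rw [← e]; ring
      _ ≤ t ^ 2 := hC
      _ = t * t := sq t
      _ ≤ t * (2 * L) := Nat.mul_le_mul_left _ ht
      _ ≤ 4 * (2 * L) := Nat.mul_le_mul_right _ ht4
      _ = 4 * L * 2 := by ring
  exact Nat.le_of_mul_le_mul_left key (by positivity)

/-- **`#H¹(K_w, E) ≤ 2` at every infinite place `w`** (Milne, *ADT*, I Rem. 3.7: `H¹(ℝ, E)` is dual to
`π₀(E(ℝ))`, and `H¹(ℂ, E) = 0`). Proof by counting: `H¹(K_w, E) = H¹(K_w, E)[2]`;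
`#H¹(K_w, E)[2] · #𝓛^{(2)} = #H¹(K_w, E[2])`; `4 · #H¹(K_w, E[2]) ≤ (#E(K_w)[2])²`; `#E(K_w)[2] ≤ 2 · #𝓛^{(2)}`
and `≤ #E[2] = 4`. In particular `H¹(K_w, E)` is finite (as a `Nat.card` statement: the bound is on
`Nat.card`, which the local Kummer sequence shows to be positive). [cite: MilneADT2006, I Rem. 3.7] -/
theorem natCard_localH1_le_two_infinitePlace (w : InfinitePlace K) :
    Nat.card (galoisCohomology (W.localGaloisModule w.Completion) 1) ≤ 2 := by
  haveI := finite_absoluteGaloisGroup_completion_infinitePlace w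
  have hΓ := natCard_absoluteGaloisGroup_completion_infinitePlace_le_two w
  haveI : CharZero w.Completion :=
    charZero_of_injective_algebraMap (algebraMap K w.Completion).injective
  have hn2 : (2 : ℤ) ≠ 0 := two_ne_zero
  haveI := W.finite_galoisCohomology_one_torsion_restrictField_of_finite w.Completion hn2
  have hL2pos : 0 < Nat.card (W.kummerLocalConditionAt 2 w.Completion) := Nat.card_pos
  -- the local Kummer sequence at level `2`, and `H¹(K_w, E)[2] = ⊤`
  have e2 := W.natCard_torsionBy_mul_natCard_kummerLocalConditionAt w.Completion hn2
  rw [W.torsionBy_galoisCohomology_localGaloisModule_eq_top_infinitePlace w (dvd_refl 2),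
    AddSubgroup.card_top] at e2
  -- `4 · #H¹(K_w, E[2]) ≤ (#E(K_w)[2])²`, `#E(K_w)[2] ≤ 4`
  let X₂ := (GaloisRep.restrictField w.Completion (W.torsionGaloisModule 2)).toTopRep
  haveI : Finite (geomTorsion W 2) := finite_torsionPoints_holds W (AlgebraicClosure K) hn2
  have hC1 := natCard_continuousCohomology_one_mul_card_le_sq_of_natCard_le_two hΓ X₂
    fun T => W.two_nsmul_geomTorsion_two T
  have hM : Nat.card X₂ = 4 := by
    have h := card_torsionPoints_eq_sq_holds W (AlgebraicClosure K) (n := 2) two_ne_zero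
    norm_num at h
    exact h
  have hInv : Nat.card {x : X₂ // ∀ g, X₂.ρ g x = x} =
      Nat.card (zsmulAddGroupHom 2 : (W.baseChange w.Completion).toAffine.Point →+ _).ker := by
    rw [← Nat.card_congr (W.invariantsTorsionEquivKerZSMul w.Completion hn2).toEquiv]
    exact Nat.card_congr (Equiv.subtypeEquivRight fun x => by
      rw [ContinuousRep.mem_invariants]; rfl)
  have hker_le : Nat.card (zsmulAddGroupHom 2 : (W.baseChange w.Completion).toAffine.Point →+ _).ker ≤ 4 := by
    rw [← hInv, ← hM]
    exact Nat.card_le_card_of_injective _ Subtype.val_injective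
  have hC1' : 4 * Nat.card (galoisCohomology (GaloisRep.restrictField w.Completion
      (W.torsionGaloisModule 2)) 1) ≤
        Nat.card (zsmulAddGroupHom 2 : (W.baseChange w.Completion).toAffine.Point →+ _).ker ^ 2 := by
    rw [← hInv, mul_comm]
    exact hM ▸ hC1
  -- the real input `#E(K_w)[2] ≤ 2 · #𝓛^{(2)}` (trivially true at a complex place too: there `H¹ = 0`)
  rcases w.isReal_or_isComplex with hw | hw
  · have i2 := W.natCard_kummerLocalConditionAt_eq_index w.Completion hn2
    have ht : Nat.card (zsmulAddGroupHom 2 : (W.baseChange w.Completion).toAffine.Point →+ _).ker ≤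
        2 * Nat.card (W.kummerLocalConditionAt 2 w.Completion) := by
      rw [i2]
      exact W.natCard_ker_two_le_two_mul_index_of_isReal w hw hker_le (i2 ▸ hL2pos.ne')
    exact le_two_of_counts e2 hC1' ht hker_le hL2pos
  · -- complex place: `Γ_{K_w} = 1`, `H¹ = 0`
    haveI : IsAlgClosed w.Completion :=
      isAlgClosed_of_ringEquiv (InfinitePlace.Completion.ringEquivComplexOfIsComplex hw).symm
    haveI := subsingleton_absoluteGaloisGroup_of_isAlgClosed w.Completion
    haveI : Subsingleton (galoisCohomology (W.localGaloisModule w.Completion) 1) :=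
      ⟨fun a b => (galoisCohomology_one_eq_zero_of_subsingleton _ a).trans
        (galoisCohomology_one_eq_zero_of_subsingleton _ b).symm⟩
    rw [Nat.card_of_subsingleton (0 : galoisCohomology (W.localGaloisModule w.Completion) 1)]
    omega

/-- **`H¹(K_w, E)` is finite at an infinite place** (its `Nat.card` is positive by the local Kummer sequence and
bounded by `2`). [cite: MilneADT2006, I Rem. 3.7] -/
theorem finite_localH1_infinitePlace (w : InfinitePlace K) :
    Finite (galoisCohomology (W.localGaloisModule w.Completion) 1) := by
  haveI := finite_absoluteGaloisGroup_completion_infinitePlace w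
  haveI : CharZero w.Completion :=
    charZero_of_injective_algebraMap (algebraMap K w.Completion).injective
  have hn2 : (2 : ℤ) ≠ 0 := two_ne_zero
  haveI := W.finite_galoisCohomology_one_torsion_restrictField_of_finite w.Completion hn2
  have e2 := W.natCard_torsionBy_mul_natCard_kummerLocalConditionAt w.Completion hn2
  rw [W.torsionBy_galoisCohomology_localGaloisModule_eq_top_infinitePlace w (dvd_refl 2),
    AddSubgroup.card_top] at e2
  refine Nat.finite_of_card_ne_zero fun h0 => ?_
  have hpos : 0 < Nat.card (galoisCohomology (GaloisRep.restrictField w.Completion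
      (W.torsionGaloisModule 2)) 1) := Nat.card_pos
  rw [← e2, h0, zero_mul] at hpos
  exact lt_irrefl 0 hpos

/-- **The local kernel at an infinite place has index `≤ 2`**: `[H¹(K, E) : ker (H¹(K, E) → H¹(K_w, E))] ≤ 2`
(the quotient embeds in `H¹(K_w, E)`, of order `≤ 2`). [cite: MilneADT2006, I Rem. 3.7] -/
theorem index_localRestrictionKer_infinitePlace_le_two (w : InfinitePlace K) :
    (W.localRestrictionKer w.Completion).index ≤ 2 := by
  haveI : Finite (W.localH1 w.Completion) := by
    rw [← galoisCohomology_localGaloisModule_one]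
    exact W.finite_localH1_infinitePlace w
  have hle : Nat.card (W.localH1 w.Completion) ≤ 2 := by
    rw [← galoisCohomology_localGaloisModule_one]
    exact W.natCard_localH1_le_two_infinitePlace w
  rw [localRestrictionKer_eq_ker, AddSubgroup.index_ker]
  exact (AddSubgroup.card_le_card_addGroup _).trans hle

/-- **The level-`n` Selmer condition at an infinite place has index `≤ 2` in `H¹(K, E[n])`** (for every
`n : ℤ`): `selmerLocalKer W K_w n` is the preimage of the local kernel under `H¹(K, E[n]) → H¹(K, E)`
(`selmerLocalKer_eq_comap`), and preimages do not increase the index. So relaxing the archimedean Selmer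
condition at one real place costs at most ONE bit. [cite: MilneADT2006, I Rem. 3.7] -/
theorem index_selmerLocalKer_infinitePlace_le_two (w : InfinitePlace K) (n : ℤ) :
    (selmerLocalKer W w.Completion n).index ≤ 2 := by
  have h2 := W.index_localRestrictionKer_infinitePlace_le_two w
  have hne : (W.localRestrictionKer w.Completion).index ≠ 0 := by
    haveI : Finite (W.localH1 w.Completion) := by
      rw [← galoisCohomology_localGaloisModule_one]
      exact W.finite_localH1_infinitePlace w
    rw [localRestrictionKer_eq_ker, AddSubgroup.index_ker]
    exact Nat.card_pos.ne'
  rw [selmerLocalKer_eq_comap, AddSubgroup.index_comap]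
  refine le_trans ?_ h2
  rw [← AddSubgroup.relIndex_top_right]
  exact AddSubgroup.relIndex_le_of_le_right le_top (by rwa [AddSubgroup.relIndex_top_right])

end WeierstrassCurve

end
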